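import Literature.Probability.RandomPlanarGeometry.ConformalRemovabilityRays
import HarnessLib

/-!
# Conformal removability: finite chains, König rays and landing points (Jones–Smirnov Thm. 2)

Support for the proof of `JonesSmirnov2000_frontier_of_isHolderDomain` (Jones–Smirnov 2000,
Cor. 2; `ConformalRemovability.lean`), continuing `ConformalRemovabilityRays.lean` (same
abstract rooted graph: `parent`, levels `q`, radii `rad`, positions `pos`, constant `κ`). In the
proof of Theorem 2 (P. W. Jones, S. K. Smirnov, Ark. Mat. 38 (2000), §3, p. 274) one needs that
EVERY boundary point is the landing point of a curve of the tree family: "There are Whitney cubes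
arbitrarily close to `z` ... Since any Whitney cube intersects only finitely many other Whitney
cubes, we can apply Cantor's diagonal argument to find ... a curve `γ ∈ Γ` such that ... the
first `j` cubes in `γ_j` and `γ` coincide ... so `y = z` and the curve `γ ∈ Γ` lands at `z`."
This file proves exactly that, for the abstract graph:

* finite chains `c 0, …, c m` (`parent (c (i+1)) = c i`, `c (i+1) ≠ root` for `i < m`):
  `q_apply_chain`, `sum_rad_chain_le` (Cauchy–Schwarz: `Σ_{i ≤ m} rad (c i) ≤ √M √(2/(q (c 0)+1))`
  with `M = Σ_v (q v + 1)² rad v²`), `dist_pos_chain_le` (`|pos (c 0) - pos (c m)| ≤ 2κ √M √(2/(q (c 0)+1))`);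
* descendants (`{t ∈ T | ∃ m, parent^[m] t = v ∧ ∀ i < m, parent^[i] t ≠ root}`, written out;
  `descendants_root_eq`, `descendants_diff_subset`): `dist_pos_le_of_iterate_parent_eq` — if `parent^[m] t = v` with no root on the
  way then `|pos v - pos t| ≤ 2κ √M √(2/(q v + 1))`;
* **König's lemma** for parent-trees with finite fibres, `exists_ray_infinite_descendants`: an
  infinite set of vertices `T` (each of which reaches the root) is met by the descendant sets of
  all vertices of some ray from the root ("good vertex" pigeonhole; no compactness needed);
* **landing**, `exists_ray_tendsto` — if the positions of `T` accumulate only at `z` then some ray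
  from the root has positions converging to `z` (Cantor's diagonal argument of p. 274).

## References

* [JonesSmirnov2000] P. W. Jones, S. K. Smirnov, *Removability theorems for Sobolev functions and
  quasiconformal maps*, Ark. Mat. 38 (2000) 263–279, §3, proof of Thm. 2 (p. 274).
-/

noncomputable section

open Set Filter Finset Metric
open scoped Topology BigOperators

namespace Literature.Probability.RandomPlanarGeometry

section Chains

variable {V : Type*} {root : V} {parent : V → V} {q : V → ℕ} {rad : V → ℝ} {pos : V → ℂ}
  {κ : ℝ} {c : ℕ → V} {m : ℕ}

/-- Along a finite chain the level increases by one at each step. [folklore] -/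
theorem q_apply_chain (hq : ∀ v, v ≠ root → q v = q (parent v) + 1)
    (hc : ∀ i < m, parent (c (i + 1)) = c i) (hc0 : ∀ i < m, c (i + 1) ≠ root) :
    ∀ i ≤ m, q (c i) = q (c 0) + i := by
  intro i hi
  induction i with
  | zero => simp
  | succ i ih =>
    rw [hq _ (hc0 i (by omega)), hc i (by omega), ih (by omega)]
    ring

/-- A finite chain visits no vertex twice. [folklore] -/
theorem injOn_chain (hq : ∀ v, v ≠ root → q v = q (parent v) + 1)
    (hc : ∀ i < m, parent (c (i + 1)) = c i) (hc0 : ∀ i < m, c (i + 1) ≠ root) :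
    Set.InjOn c {i | i ≤ m} := by
  intro i hi j hj h
  have := congrArg q h
  rw [q_apply_chain hq hc hc0 i hi, q_apply_chain hq hc hc0 j hj] at this
  omega

/-- **Cauchy–Schwarz along a finite chain**: `Σ_{i ≤ m} rad (c i) ≤ √(Σ_v (q v+1)² rad v²) ·
√(2/(q (c 0) + 1))` (distinct levels `q (c 0) + i`). (Jones–Smirnov 2000, p. 274, `n = 2`.)
[cite: JonesSmirnov2000, §3 proof of Thm. 2 (p. 274)] -/
theorem sum_rad_chain_le (hq : ∀ v, v ≠ root → q v = q (parent v) + 1)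
    (hc : ∀ i < m, parent (c (i + 1)) = c i) (hc0 : ∀ i < m, c (i + 1) ≠ root)
    (hrad : ∀ v, 0 ≤ rad v) (hsum : Summable fun v => ((q v : ℝ) + 1) ^ 2 * rad v ^ 2) :
    ∑ i ∈ range (m + 1), rad (c i) ≤
      Real.sqrt (∑' v, ((q v : ℝ) + 1) ^ 2 * rad v ^ 2) * Real.sqrt (2 / ((q (c 0) : ℝ) + 1)) := by
  classical
  set M : ℝ := ∑' v, ((q v : ℝ) + 1) ^ 2 * rad v ^ 2 with hM
  set a : ℕ → ℝ := fun n => ((q (c n) : ℝ) + 1) * rad (c n) with ha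
  set b : ℕ → ℝ := fun n => 1 / (((q (c n)) : ℝ) + 1) with hb
  have hab : ∀ n, rad (c n) = a n * b n := fun n => by
    simp only [ha, hb]
    field_simp
  have hlevel : ∀ n ∈ range (m + 1), (q (c n) : ℝ) = (q (c 0) : ℝ) + n := fun n hn => by
    rw [q_apply_chain hq hc hc0 n (by simpa [Nat.lt_succ_iff] using hn)]
    push_cast
    ring
  have hA : ∑ n ∈ range (m + 1), a n ^ 2 ≤ M := by
    have hinj : Set.InjOn c ↑(range (m + 1)) := fun i hi j hj h =>
      injOn_chain hq hc hc0 (by simpa [Nat.lt_succ_iff] using hi)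
        (by simpa [Nat.lt_succ_iff] using hj) h
    calc ∑ n ∈ range (m + 1), a n ^ 2
        = ∑ n ∈ range (m + 1), (fun v => ((q v : ℝ) + 1) ^ 2 * rad v ^ 2) (c n) :=
          sum_congr rfl fun n _ => by simp only [ha]; ring
      _ = ∑ v ∈ (range (m + 1)).image c, ((q v : ℝ) + 1) ^ 2 * rad v ^ 2 := by
          rw [sum_image hinj]
      _ ≤ M := hsum.sum_le_tsum _ fun v _ => by positivity
  have hB : ∑ n ∈ range (m + 1), b n ^ 2 ≤ 2 / ((q (c 0) : ℝ) + 1) := by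
    have := sum_range_inv_sq_le (q (c 0)) (m + 1)
    calc ∑ n ∈ range (m + 1), b n ^ 2
        = ∑ n ∈ range (m + 1), (1 : ℝ) / (((q (c 0)) : ℝ) + 1 + n) ^ 2 :=
          sum_congr rfl fun n hn => by
            rw [hb]
            dsimp only
            rw [hlevel n hn, div_pow, one_pow]
            congr 1
            ring
      _ ≤ 2 / ((q (c 0) : ℝ) + 1) := this
  have hCS : (∑ n ∈ range (m + 1), a n * b n) ^ 2 ≤
      (∑ n ∈ range (m + 1), a n ^ 2) * ∑ n ∈ range (m + 1), b n ^ 2 :=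
    sum_mul_sq_le_sq_mul_sq _ _ _
  have hnonneg : 0 ≤ ∑ n ∈ range (m + 1), a n * b n :=
    sum_nonneg fun n _ => by rw [← hab]; exact hrad _
  calc ∑ n ∈ range (m + 1), rad (c n) = ∑ n ∈ range (m + 1), a n * b n :=
        sum_congr rfl fun n _ => hab n
    _ = Real.sqrt ((∑ n ∈ range (m + 1), a n * b n) ^ 2) := (Real.sqrt_sq hnonneg).symm
    _ ≤ Real.sqrt ((∑ n ∈ range (m + 1), a n ^ 2) * ∑ n ∈ range (m + 1), b n ^ 2) :=
        Real.sqrt_le_sqrt hCS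
    _ = Real.sqrt (∑ n ∈ range (m + 1), a n ^ 2) * Real.sqrt (∑ n ∈ range (m + 1), b n ^ 2) :=
        Real.sqrt_mul (sum_nonneg fun _ _ => by positivity) _
    _ ≤ Real.sqrt M * Real.sqrt (2 / ((q (c 0) : ℝ) + 1)) := by gcongr

/-- **Finite chains are short**: `|pos (c 0) - pos (c m)| ≤ 2κ √(Σ_v (q v+1)² rad v²) √(2/(q (c 0)+1))`.
[cite: JonesSmirnov2000, §3 proof of Thm. 2 (p. 274)] -/
theorem dist_pos_chain_le (hq : ∀ v, v ≠ root → q v = q (parent v) + 1)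
    (hpos : ∀ v, dist (pos v) (pos (parent v)) ≤ κ * (rad v + rad (parent v))) (hκ : 0 ≤ κ)
    (hc : ∀ i < m, parent (c (i + 1)) = c i) (hc0 : ∀ i < m, c (i + 1) ≠ root)
    (hrad : ∀ v, 0 ≤ rad v) (hsum : Summable fun v => ((q v : ℝ) + 1) ^ 2 * rad v ^ 2) :
    dist (pos (c 0)) (pos (c m)) ≤ 2 * κ * (Real.sqrt (∑' v, ((q v : ℝ) + 1) ^ 2 * rad v ^ 2) *
      Real.sqrt (2 / ((q (c 0) : ℝ) + 1))) := by
  have hstep : ∀ i ∈ range m, dist (pos (c i)) (pos (c (i + 1))) ≤ κ * (rad (c (i + 1)) + rad (c i)) :=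
    fun i hi => by
      have him : i < m := mem_range.1 hi
      rw [dist_comm, ← hc i him]
      exact (hpos (c (i + 1))).trans_eq (by rw [hc i him])
  have hS := sum_rad_chain_le hq hc hc0 hrad hsum
  set S := ∑ i ∈ range (m + 1), rad (c i) with hSdef
  have h1 : ∑ i ∈ range m, rad (c (i + 1)) ≤ S := by
    rw [hSdef, sum_range_succ']
    linarith [hrad (c 0)]
  have h2 : ∑ i ∈ range m, rad (c i) ≤ S := by
    rw [hSdef, sum_range_succ]
    linarith [hrad (c m)]
  calc dist (pos (c 0)) (pos (c m))
      ≤ ∑ i ∈ range m, dist (pos (c i)) (pos (c (i + 1))) := dist_le_range_sum_dist (fun i => pos (c i)) m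
    _ ≤ ∑ i ∈ range m, κ * (rad (c (i + 1)) + rad (c i)) := sum_le_sum hstep
    _ = κ * (∑ i ∈ range m, rad (c (i + 1)) + ∑ i ∈ range m, rad (c i)) := by
        rw [← mul_sum, sum_add_distrib]
    _ ≤ κ * (S + S) := by gcongr
    _ ≤ 2 * κ * (Real.sqrt (∑' v, ((q v : ℝ) + 1) ^ 2 * rad v ^ 2) *
          Real.sqrt (2 / ((q (c 0) : ℝ) + 1))) := by nlinarith

/-- **Descendants are close to their ancestors**: if `parent^[m] t = v` and none of
`t, parent t, …, parent^[m-1] t` is the root, then `|pos v - pos t| ≤ 2κ √(Σ_v (q v+1)² rad v²)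
√(2/(q v + 1))` (the chain `v = parent^[m] t, …, parent t, t`). [cite: JonesSmirnov2000, §3 proof of Thm. 2 (p. 274)] -/
theorem dist_pos_le_of_iterate_parent_eq (hq : ∀ v, v ≠ root → q v = q (parent v) + 1)
    (hpos : ∀ v, dist (pos v) (pos (parent v)) ≤ κ * (rad v + rad (parent v))) (hκ : 0 ≤ κ)
    (hrad : ∀ v, 0 ≤ rad v) (hsum : Summable fun v => ((q v : ℝ) + 1) ^ 2 * rad v ^ 2)
    {v t : V} {m : ℕ} (ht : parent^[m] t = v) (ht0 : ∀ i < m, parent^[i] t ≠ root) :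
    dist (pos v) (pos t) ≤ 2 * κ * (Real.sqrt (∑' v, ((q v : ℝ) + 1) ^ 2 * rad v ^ 2) *
      Real.sqrt (2 / ((q v : ℝ) + 1))) := by
  set c : ℕ → V := fun i => parent^[m - i] t with hcdef
  have hc : ∀ i < m, parent (c (i + 1)) = c i := fun i hi => by
    simp only [hcdef]
    rw [← Function.iterate_succ_apply' parent (m - (i + 1)) t]
    congr 1
    omega
  have hc0 : ∀ i < m, c (i + 1) ≠ root := fun i hi => ht0 (m - (i + 1)) (by omega)
  have h0 : c 0 = v := by simp [hcdef, ht]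
  have hm : c m = t := by simp [hcdef]
  have := dist_pos_chain_le hq hpos hκ hc hc0 hrad hsum
  rwa [h0, hm] at this

end Chains

/-! ### König's lemma for parent-trees with finite fibres -/

section Konig

variable {V : Type*} {root : V} {parent : V → V}

/-! The DESCENDANTS of `v` inside `T` are the `t ∈ T` with `parent^[m] t = v` for some `m`, no
root occurring among `t, …, parent^[m-1] t`; we write this set out explicitly in each statement:
`{t ∈ T | ∃ m, parent^[m] t = v ∧ ∀ i < m, parent^[i] t ≠ root}`. -/

/-- Every vertex that reaches the root is a descendant of the root. [folklore] -/
theorem descendants_root_eq (T : Set V) (hreach : ∀ t ∈ T, ∃ n, parent^[n] t = root) :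
    {t ∈ T | ∃ m, parent^[m] t = root ∧ ∀ i < m, parent^[i] t ≠ root} = T := by
  classical
  refine Subset.antisymm (fun _ ht => ht.1) fun t ht => ⟨ht, ?_⟩
  have h : ∃ n, parent^[n] t = root := hreach t ht
  exact ⟨Nat.find h, Nat.find_spec h, fun i hi => Nat.find_min h hi⟩

/-- A proper descendant of `v` is a descendant of a child of `v`. [folklore] -/
theorem descendants_diff_subset (T : Set V) (v : V) :
    {t ∈ T | ∃ m, parent^[m] t = v ∧ ∀ i < m, parent^[i] t ≠ root} \ {v} ⊆
      ⋃ w ∈ {w | parent w = v ∧ w ≠ root},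
        {t ∈ T | ∃ m, parent^[m] t = w ∧ ∀ i < m, parent^[i] t ≠ root} := by
  rintro t ⟨⟨htT, m, hm, hm0⟩, htv⟩
  have hmpos : m ≠ 0 := by
    rintro rfl
    exact htv (by simpa using hm)
  obtain ⟨k, rfl⟩ : ∃ k, m = k + 1 := ⟨m - 1, by omega⟩
  refine mem_iUnion₂.2 ⟨parent^[k] t, ⟨?_, hm0 k (by omega)⟩, htT, k, rfl, fun i hi => hm0 i (by omega)⟩
  rw [← Function.iterate_succ_apply' parent k t]
  exact hm

/-- **König's lemma** for a parent-tree with finite fibres: if `T` is an infinite set of vertices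
each of which reaches the root under iteration of `parent`, then there is a ray
`root = x 0, x 1, x 2, …` (`parent (x (n+1)) = x n`, `x (n+1) ≠ root`) every vertex of which has
infinitely many descendants in `T`. Proof: call `v` good if it has infinitely many descendants in
`T`; the root is good, and a good vertex has a good child because its proper descendants are
covered by the descendant sets of its finitely many children. (The "Cantor diagonal argument" of
Jones–Smirnov 2000, p. 274.) [folklore] -/
theorem exists_ray_infinite_descendants (hfin : ∀ v, {w | parent w = v ∧ w ≠ root}.Finite)
    {T : Set V} (hT : T.Infinite) (hreach : ∀ t ∈ T, ∃ n, parent^[n] t = root) :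
    ∃ x : ℕ → V, x 0 = root ∧ (∀ n, parent (x (n + 1)) = x n) ∧ (∀ n, x (n + 1) ≠ root) ∧
      ∀ n, {t ∈ T | ∃ m, parent^[m] t = x n ∧ ∀ i < m, parent^[i] t ≠ root}.Infinite := by
  classical
  -- descendants of `v` in `T`
  set D : V → Set V := fun v => {t ∈ T | ∃ m, parent^[m] t = v ∧ ∀ i < m, parent^[i] t ≠ root}
    with hD
  -- a good vertex has a good child
  have step : ∀ v, (D v).Infinite → ∃ w, parent w = v ∧ w ≠ root ∧ (D w).Infinite := by
    intro v hv
    by_contra h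
    push Not at h
    have hfinU : (⋃ w ∈ {w | parent w = v ∧ w ≠ root}, D w).Finite :=
      (hfin v).biUnion fun w hw => h w hw.1 hw.2
    have : (D v \ {v}).Finite := hfinU.subset (descendants_diff_subset T v)
    exact hv (this.of_sdiff (Set.finite_singleton v))
  choose! g hg using step
  -- the ray of good vertices
  set x : ℕ → V := fun n => Nat.rec root (fun _ v => g v) n with hxdef
  have hx0 : x 0 = root := rfl
  have hxs : ∀ n, x (n + 1) = g (x n) := fun n => rfl
  have hgood : ∀ n, (D (x n)).Infinite := by
    intro n
    induction n with
    | zero => rw [hx0]; simp only [hD]; rwa [descendants_root_eq T hreach]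
    | succ n ih => rw [hxs]; exact (hg _ ih).2.2
  refine ⟨x, hx0, fun n => ?_, fun n => ?_, hgood⟩
  · rw [hxs]; exact (hg _ (hgood n)).1
  · rw [hxs]; exact (hg _ (hgood n)).2.1

end Konig

/-! ### Landing at accumulation points -/

section Landing

variable {V : Type*} {root : V} {parent : V → V} {q : V → ℕ} {rad : V → ℝ} {pos : V → ℂ}
  {κ : ℝ}

/-- **Every accumulation point of the graph is a landing point of a ray** (Jones–Smirnov 2000,
p. 274: every boundary point is the landing point of a curve of the tree family). Let `T` be an
infinite set of vertices reaching the root, whose positions accumulate only at `z`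
(for every `ε > 0` only finitely many `t ∈ T` have `|pos t - z| ≥ ε`). If the fibres of `parent`
are finite and `Σ_v (q v+1)² rad v² < ∞`, then some ray from the root has positions converging to
`z`: take the König ray; its `n`-th vertex has descendants in `T` arbitrarily close to `z`, all
within `2κ √M √(2/(q root + n + 1))` of `pos (x n)`. [cite: JonesSmirnov2000, §3 proof of Thm. 2 (p. 274)] -/
theorem exists_ray_tendsto (hq : ∀ v, v ≠ root → q v = q (parent v) + 1)
    (hpos : ∀ v, dist (pos v) (pos (parent v)) ≤ κ * (rad v + rad (parent v))) (hκ : 0 ≤ κ)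
    (hrad : ∀ v, 0 ≤ rad v) (hsum : Summable fun v => ((q v : ℝ) + 1) ^ 2 * rad v ^ 2)
    (hfin : ∀ v, {w | parent w = v ∧ w ≠ root}.Finite)
    {T : Set V} (hT : T.Infinite) (hreach : ∀ t ∈ T, ∃ n, parent^[n] t = root) {z : ℂ}
    (hz : ∀ ε > 0, {t ∈ T | ε ≤ dist (pos t) z}.Finite) :
    ∃ x : ℕ → V, x 0 = root ∧ (∀ n, parent (x (n + 1)) = x n) ∧ (∀ n, x (n + 1) ≠ root) ∧
      Tendsto (fun n => pos (x n)) atTop (𝓝 z) := by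
  obtain ⟨x, hx0, hx, hxr, hgood⟩ := exists_ray_infinite_descendants hfin hT hreach
  refine ⟨x, hx0, hx, hxr, ?_⟩
  set M : ℝ := ∑' v, ((q v : ℝ) + 1) ^ 2 * rad v ^ 2 with hM
  set B : ℕ → ℝ := fun n => 2 * κ * (Real.sqrt M * Real.sqrt (2 / ((q root : ℝ) + n + 1))) with hB
  -- pointwise bound `dist (pos (x n)) z ≤ B n`
  have hbound : ∀ n, dist (pos (x n)) z ≤ B n := by
    intro n
    refine le_of_forall_pos_lt_add fun ε hε => ?_
    -- a descendant of `x n` in `T` within `ε` of `z`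
    obtain ⟨t, ⟨htT, m, hm, hm0⟩, htε⟩ :
        ∃ t ∈ {t ∈ T | ∃ m, parent^[m] t = x n ∧ ∀ i < m, parent^[i] t ≠ root},
          dist (pos t) z < ε := by
      by_contra h
      push Not at h
      have hsub : {t ∈ T | ∃ m, parent^[m] t = x n ∧ ∀ i < m, parent^[i] t ≠ root} ⊆
          {t ∈ T | ε ≤ dist (pos t) z} := fun t ht => ⟨ht.1, h t ht⟩
      exact hgood n ((hz ε hε).subset hsub)
    have hq' : q (x n) = q root + n := by rw [← hx0]; exact q_apply_ray hq hx hxr n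
    have hd := dist_pos_le_of_iterate_parent_eq hq hpos hκ hrad hsum hm hm0
    rw [hq'] at hd
    push_cast at hd
    calc dist (pos (x n)) z ≤ dist (pos (x n)) (pos t) + dist (pos t) z := dist_triangle _ _ _
      _ < B n + ε := add_lt_add_of_le_of_lt hd htε
  -- `B n → 0`
  have hB0 : Tendsto B atTop (𝓝 0) := by
    have h1 : Tendsto (fun n : ℕ => 2 / ((q root : ℝ) + n + 1)) atTop (𝓝 0) := by
      have : Tendsto (fun n : ℕ => ((q root : ℝ) + n + 1)) atTop atTop := by
        refine tendsto_atTop_add_const_right _ _ ?_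
        exact tendsto_atTop_add_const_left _ _ tendsto_natCast_atTop_atTop
      exact tendsto_const_nhds.div_atTop this
    have h2 : Tendsto (fun n : ℕ => Real.sqrt (2 / ((q root : ℝ) + n + 1))) atTop (𝓝 0) := by
      simpa using h1.sqrt
    have h3 := h2.const_mul (2 * κ * Real.sqrt M)
    rw [mul_zero] at h3
    refine h3.congr fun n => ?_
    simp only [hB]
    ring
  rw [tendsto_iff_dist_tendsto_zero]
  exact squeeze_zero (fun _ => dist_nonneg) hbound hB0

end Landing

end Literature.Probability.RandomPlanarGeometry
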